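import Summits.ValiantsHypothesis.ValiantsHypothesis.Theses.LacunarySymmetroid
import Summits.ValiantsHypothesis.ValiantsHypothesis.Theorems.LacunarySymmetroidMatrixDescartesCensusDefs
import Summits.ValiantsHypothesis.ValiantsHypothesis.Theorems.LacunarySymmetroidMatrixDescartesCensusKThreeColumn
import Summits.ValiantsHypothesis.ValiantsHypothesis.Theorems.LacunarySymmetroidMatrixDescartesCensusKLawBridge
import Summits.ValiantsHypothesis.ValiantsHypothesis.Theorems.LacunarySymmetroidMatrixDescartesCensusExtremalVsCrux

/-!
# `MatrixDescartes` — the thin-format conjecture `DescartesExtremalThin`: links and reduction to its open part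

HONEST FRAMING.  Object-search cell `pub-symmetroid`, crux `Theses.LacunarySymmetroid.MatrixDescartes`
(stmt-ValiantsHypothesis-18050).  `DescartesExtremalThin` (STRUCTURE §2.2 after R45) and `FormatExtremalAll` (the all-formats
hypothesis of the fork theorem) are typed in the Defs module and are NOT asserted here.  This file proves: the all-formats law
refutes the crux (restated through the definition) and implies the thin law; the thin law implies `KThreeColumnLaw` (A3); and the
thin law is EQUIVALENT to the conjunction of its three OPEN parts — `K = 3, m ≥ 8`, `m = 2, K ≥ 6`, `m = 3, K ≥ 4` (lower halves)
— everything else in its scope being a kernel theorem (`Census.row_one`, `row_two`, `a3_column_le_seven`, `posRootLaw_two_four_sharp`,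
`row_2_5`).  Finite bookkeeping; nothing about the crux is proved or refuted unconditionally; no claim about `VP ≠ VNP`.
-/

-- `Summit.ValiantsHypothesis.ValiantsHypothesis.…` repeats a component by the D-0017 layout
-- (single-conjunct summit), which the `dupNamespace` linter flags; the name is mandated.
set_option linter.dupNamespace false

namespace Summit.ValiantsHypothesis.ValiantsHypothesis.Theorems.LacunarySymmetroidMatrixDescartes.Census

open Summit.ValiantsHypothesis.ValiantsHypothesis.Theorems.MatrixDescartes.Negative (PosRootLawAt)
open Summit.ValiantsHypothesis.ValiantsHypothesis.Theses.LacunarySymmetroid (MatrixDescartes)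

/-- **The all-formats law refutes the crux** (the fork theorem through the definition). [folklore] -/
theorem not_matrixDescartes_of_formatExtremalAll (h : FormatExtremalAll) : ¬ MatrixDescartes :=
  not_matrixDescartes_of_formatExtremal fun m K hm hK => (h m K hm hK).2

/-- **The all-formats law also refutes Conjecture B** (`KPlusLogSqLaw`), since B implies the crux
(`Census.matrixDescartes_of_kPlusLogSqLaw`). [folklore] -/
theorem not_kPlusLogSqLaw_of_formatExtremalAll (h : FormatExtremalAll) : ¬ KPlusLogSqLaw :=
  fun hB => not_matrixDescartes_of_formatExtremalAll h (matrixDescartes_of_kPlusLogSqLaw hB)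

/-- The all-formats law trivially contains the thin law. [folklore] -/
theorem descartesExtremalThin_of_formatExtremalAll (h : FormatExtremalAll) : DescartesExtremalThin :=
  fun m K hm hK _ => h m K hm (by omega)

/-- **The thin law contains Conjecture A3** (`K = 3` is thin for every `m`). [folklore] -/
theorem kThreeColumnLaw_of_descartesExtremalThin (h : DescartesExtremalThin) : KThreeColumnLaw := by
  intro m hm
  have h' := h m 3 hm (by norm_num) (by omega)
  have e1 : m + 3 - 1 = m + 2 := by omega
  have e2 : (m + 2).choose m = (m + 2).choose 2 := Nat.choose_symm_add
  rw [e1, e2] at h'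
  exact h'

/-- The upper half of the thin law (indeed of every format) is Descartes' rule. [folklore] -/
theorem descartes_upper (m K : ℕ) (hK : 1 ≤ K) : PosRootLawAt m K (Nat.choose (m + K - 1) m - 1) :=
  posRootLawAt_descartes m K (by omega)

/-- **Reduction of the thin law to its open part.**  `DescartesExtremalThin` holds iff (a) `K = 3` for all `m ≥ 8`,
(b) `m = 2` for all `K ≥ 6` and (c) `m = 3` for all `K ≥ 4` hold (lower halves); the rest of its scope — `K = 2` (all `m`),
`m = 1` (all `K`), `K = 3` with `m ≤ 7`, `(2,4)`, `(2,5)` — is already in the kernel. [folklore] -/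
theorem descartesExtremalThin_iff_open :
    DescartesExtremalThin ↔
      (∀ m : ℕ, 8 ≤ m → ¬ PosRootLawAt m 3 (Nat.choose (m + 2) 2 - 2)) ∧
      (∀ K : ℕ, 6 ≤ K → ¬ PosRootLawAt 2 K (Nat.choose (K + 1) 2 - 2)) ∧
      (∀ K : ℕ, 4 ≤ K → ¬ PosRootLawAt 3 K (Nat.choose (K + 2) 3 - 2)) := by
  constructor
  · intro h
    refine ⟨fun m hm => ?_, fun K hK => ?_, fun K hK => ?_⟩
    · have h' := (h m 3 (by omega) (by norm_num) (by omega)).2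
      have e : (m + 2).choose m = (m + 2).choose 2 := Nat.choose_symm_add
      simpa [e] using h'
    · have h' := (h 2 K (by norm_num) (by omega) (by omega)).2
      have e1 : 2 + K - 1 = K + 1 := by omega
      rw [e1] at h'
      exact h'
    · have h' := (h 3 K (by norm_num) (by omega) (by omega)).2
      have e1 : 3 + K - 1 = K + 2 := by omega
      rw [e1] at h'
      exact h'
  · rintro ⟨h3, h2, hm3⟩ m K hm hK hmin
    refine ⟨descartes_upper m K (by omega), ?_⟩
    -- case analysis on the thin scope
    rcases Nat.lt_or_ge K 4 with hK4 | hK4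
    · interval_cases K
      · -- K = 2: ζ(m,2) = m (row_two)
        have e1 : m + 2 - 1 = m + 1 := by omega
        rw [e1, Nat.choose_succ_self_right]
        simpa using (row_two m (by omega)).2
      · -- K = 3: A3 through m = 7, hypothesis (a) beyond
        have e1 : m + 3 - 1 = m + 2 := by omega
        rw [e1]
        have e : (m + 2).choose m = (m + 2).choose 2 := Nat.choose_symm_add
        rw [e]
        rcases Nat.lt_or_ge m 8 with hm8 | hm8
        · exact (a3_column_le_seven m hm (by omega)).2
        · exact h3 m hm8
    · -- K ≥ 4: then m ≤ 3
      have hm3' : m ≤ 3 := by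
        rcases Nat.le_total m K with hle | hle
        · rw [Nat.min_eq_left hle] at hmin; exact hmin
        · rw [Nat.min_eq_right hle] at hmin; omega
      interval_cases m
      · -- m = 1: Descartes is sharp for K-nomials (row_one)
        have e1 : 1 + K - 1 = K := by omega
        rw [e1, Nat.choose_one_right]
        exact (row_one K (by omega)).2
      · -- m = 2
        have e1 : 2 + K - 1 = K + 1 := by omega
        rw [e1]
        rcases Nat.lt_or_ge K 6 with hK6 | hK6
        · interval_cases K
          · -- (2,4) = 9
            simpa [Nat.choose] using posRootLaw_two_four_sharp.2
          · -- (2,5) = 14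
            simpa [Nat.choose] using row_2_5.2
        · exact h2 K hK6
      · -- m = 3
        have e1 : 3 + K - 1 = K + 2 := by omega
        rw [e1]
        exact hm3 K hK4

end Summit.ValiantsHypothesis.ValiantsHypothesis.Theorems.LacunarySymmetroidMatrixDescartes.Census
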